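import Mathlib.Tactic.SplitIfs
import Summits.Ventures.CertifiedManyBodySolver.Downfold.RouterWordScore

/-!
# Router-word score, part 2: the `PARTIAL` characterisation behind the pre-registered tensions,
# the §7 R-clause arithmetic (ACCEPTANCE v1.3 R8), and the pre-registered A10 SHADOW decision rule

Venture CertifiedManyBodySolver, cell `pub/hubbard-downfold`, seat hubbard-downfold-score-2 (session g3);
namespace `Summit.Ventures.CertifiedManyBodySolver.Downfold.RouterScore` (continues
`RouterWordScore.lean`, p462277). Everything here is PROVED; nothing is about a material.

WHAT THIS IS NOT: not the scorer of record (deputy-2 `score.py` v1.3 bb3253669f8181ea is; mirrored by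
`validation/score/router/router_score.py`), not a router amendment, and not physics. It is the kernel
reference for three ledger entries of `validation/score/PREREG.md` written BEFORE the events they score:

* §1 `outcome_partial_of_foreign_primary` — a word whose primary is none of the expected primaries but
  which CARRIES an expected primary scores `PARTIAL` (never `AGREE`, never `DISAGREE`). Instances by
  `decide`: the lead's PRE-REGISTERED HOLD-OUT CLASS EXPECTATION (PREREG Y37: a cuprate hold-out worded
  «UND:MIXED+1BH+3BE(+EPH)» against the curated [`1BH+3BE`]), lit-1's risk T1′ (Y39: «UND:MIXED+
  UND:MULTIORB+EPH» against [`UND:MULTIORB(+EPH)`]) and the router-line half of tension T(#29) (Y38).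
* §2 `rPass agree other` — the §7 rung-1 clause «R ≥ 0.90» in integers, with the v1.3 R8 denominator
  (AGREE + PARTIAL + DISAGREE + ABSTAIN(uncoded)): `rPass_iff : rPass a k ↔ 9 * k ≤ a` — every non-AGREE
  cell in the denominator costs nine AGREE cells; today's tally `rPass 41 3`; the hold-out budget
  `rPass_three_add`.
* §3 the A10 EVALUATION PROTOCOL's decision rule P-A10.5 (PREREG §E 2026-08-26T20:4xZ, proposed to the
  lead and deputy-2 before any cuprate hold-out word exists) as a total function `recommend`:
  strictly more `AGREE` among the SHADOW words on the hold-out cells AND `noRegression` over every cell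
  of record; theorems: ties keep (`recommend_self`), no-regression is reflexive and pointwise
  (`noRegression_iff_forall_zip`), and under it the AGREE count cannot drop
  (`agreeCount_le_of_noRegression`).
-/

namespace Summit.Ventures.CertifiedManyBodySolver.Downfold

namespace RouterScore

variable {α : Type*} [DecidableEq α]

/-! ## §1 Foreign primary with an expected primary carried ⇒ `PARTIAL` -/

section partialVerdict

variable (structural : α → Bool)

omit [DecidableEq α] in
/-- a full match pins the alternative's head to the emitted primary. [folklore] -/
theorem head_eq_of_fullMatch [DecidableEq α] {p : α} {tl a : List α}
    (h : fullMatch (p :: tl) a = true) : a.head? = some p := by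
  simp only [fullMatch, Bool.and_eq_true, decide_eq_true_eq, List.head?_cons] at h
  exact h.1

/-- FOREIGN PRIMARY ⇒ `PARTIAL` (ACCEPTANCE §4.2, the clause the pre-registered tensions T1 NCCO,
Y37 cuprate hold-outs, Y39 BaK122 all land on): with a registered expectation and a closed structure
gate, if NO alternative has the emitted primary as its primary but SOME alternative's primary is among
the emitted words, the verdict is `PARTIAL`. [folklore] -/
theorem outcome_partial_of_foreign_primary {p : α} {tl : List α} {alts : List (List α)}
    (halts : alts ≠ []) (hgate : (structural p && !expectsStructural structural alts) = false)
    (hforeign : ∀ a ∈ alts, a.head? ≠ some p)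
    (hcarried : ∃ a ∈ alts, primaryEmitted (p :: tl) a = true) :
    outcome structural (p :: tl) alts = .PARTIAL := by
  rw [outcome_cons, if_neg halts, if_neg (by simp [hgate])]
  have hm : ¬ alts.any (fullMatch (p :: tl)) = true := by
    intro h
    rw [List.any_eq_true] at h
    obtain ⟨a, ha, hfa⟩ := h
    exact hforeign a ha (head_eq_of_fullMatch hfa)
  have hq : alts.any (primaryEmitted (p :: tl)) = true := by
    rw [List.any_eq_true]
    exact hcarried
  rw [if_neg hm, if_pos hq]

/-- conversely, `PARTIAL` excludes a full match: no alternative with the emitted primary has all its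
tokens emitted. [folklore] -/
theorem not_fullMatch_of_partial {p : α} {tl : List α} {alts : List (List α)}
    (h : outcome structural (p :: tl) alts = .PARTIAL) : ∀ a ∈ alts, fullMatch (p :: tl) a = false := by
  intro a ha
  rw [outcome_cons] at h
  by_cases h0 : alts = []
  · rw [if_pos h0] at h; exact absurd h (by decide)
  rw [if_neg h0] at h
  by_cases hg : (structural p && !expectsStructural structural alts) = true
  · rw [if_pos hg] at h; exact absurd h (by decide)
  rw [if_neg hg] at h
  by_cases hm : alts.any (fullMatch (p :: tl)) = true
  · rw [if_pos hm] at h; exact absurd h (by decide)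
  cases hfa : fullMatch (p :: tl) a with
  | false => rfl
  | true => exact absurd (List.any_eq_true.mpr ⟨a, ha, hfa⟩) hm

end partialVerdict

section registeredInstances
open Head

/-- PREREG Y37 (lead 2026-08-26T20:02:21Z): a cuprate hold-out worded «UND:MIXED+1BH+3BE+EPH» against
the curated expectation [`1BH+3BE`] scores `PARTIAL`. [folklore] -/
example : score [undMixed, bh1, be3, eph] [[bh1, be3]] = .PARTIAL := by decide
/-- Y37, M51 YBCO:Zn variant (alternatives [`1BH+3BE+UND:DISORDER`, `1BH+3BE`]; `UND:DISORDER` is an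
open-grammar head, `other 0` here). [folklore] -/
example : score [undMixed, bh1, be3] [[bh1, be3, other 0], [bh1, be3]] = .PARTIAL := by decide
/-- Y37, the other branch of the lead's prediction: «1BH+3BE» ⇒ `AGREE`. [folklore] -/
example : score [bh1, be3] [[bh1, be3]] = .AGREE := by decide
/-- PREREG Y39 (lit-1 T1′, #25 BaK122): «UND:MIXED+UND:MULTIORB+EPH» against
[`UND:MULTIORB+EPH`, `UND:MULTIORB`] ⇒ `PARTIAL`; the unexposed word «UND:MULTIORB+EPH» ⇒ `AGREE`.
[folklore] -/
example : score [undMixed, undMultiorb, eph] [[undMultiorb, eph], [undMultiorb]] = .PARTIAL := by decide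
example : score [undMultiorb, eph] [[undMultiorb, eph], [undMultiorb]] = .AGREE := by decide
/-- PREREG Y38 (T(#29) Sr₂IrO₄, router-line half; expected [`1BH`]): any `1BH` primary ⇒ `AGREE`
whatever the annotations; another primary with `1BH` carried ⇒ `PARTIAL`; `1BH` absent ⇒ `DISAGREE`.
[folklore] -/
example : score [bh1, be3] [[bh1]] = .AGREE := by decide
example : score [undMixed, bh1] [[bh1]] = .PARTIAL := by decide
example : score [undMultiorb, bh1] [[bh1]] = .PARTIAL := by decide
example : score [undMultiorb] [[bh1]] = .DISAGREE := by decide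

end registeredInstances

/-! ## §2 The §7 R-clause in integers (ACCEPTANCE v1.3 R8 denominator) -/

/-- The rung-1 clause «R = AGREE / (AGREE + PARTIAL + DISAGREE + ABSTAIN(uncoded)) ≥ 0.90» (ACCEPTANCE
§7; v1.3 R8 put `ABSTAIN(uncoded)` into the denominator) cleared of fractions, as the boolean both
python engines print: `agree` AGREE cells and `other` further cells in the denominator pass iff
`9 · (agree + other) ≤ 10 · agree`. Abstentions `pending` / `no-word` / `structure` and `UNSCORED` are in
neither argument. [folklore] -/
def rPass (agree other : ℕ) : Bool := decide (9 * (agree + other) ≤ 10 * agree)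

/-- NINE FOR ONE: the R-clause holds iff there are at least nine AGREE cells per non-AGREE cell in the
denominator. [folklore] -/
theorem rPass_iff (agree other : ℕ) : rPass agree other = true ↔ 9 * other ≤ agree := by
  simp only [rPass, decide_eq_true_eq]; omega

/-- the clause is monotone in AGREE cells and antitone in the other denominator cells. [folklore] -/
theorem rPass_mono {a a' k k' : ℕ} (ha : a ≤ a') (hk : k' ≤ k) (h : rPass a k = true) :
    rPass a' k' = true := by
  rw [rPass_iff] at h ⊢; omega

/-- one more PARTIAL / DISAGREE / uncoded cell costs exactly nine AGREE cells. [folklore] -/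
theorem rPass_succ_iff (a k : ℕ) : rPass (a + 9) (k + 1) = true ↔ rPass a k = true := by
  rw [rPass_iff, rPass_iff]; omega

/-- with zero AGREE cells the clause holds only on an empty denominator. [folklore] -/
theorem rPass_zero_iff (k : ℕ) : rPass 0 k = true ↔ k = 0 := by
  rw [rPass_iff]; omega

/-- THE HOLD-OUT BUDGET (PREREG Y37): with the three calibration PARTIALs of record standing (NCCO,
Hg1201 ×2) and `h` further non-AGREE cells, the clause needs `27 + 9 h` AGREE cells. [folklore] -/
theorem rPass_three_add (a h : ℕ) : rPass a (3 + h) = true ↔ 27 + 9 * h ≤ a := by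
  rw [rPass_iff]; omega

/-- today's router-line tally (2026-08-26T20:13Z, ROUTER-SCORES.tsv 46 rows): 41 AGREE, 3 PARTIAL,
0 uncoded ⇒ R = 41/44 ≥ 0.90. [folklore] -/
example : rPass 41 3 = true := by decide
/-- … and it would survive exactly one more non-AGREE cell without new AGREEs (41 ≥ 36), not two
(41 < 45). [folklore] -/
example : rPass 41 4 = true ∧ rPass 41 5 = false := by decide

/-! ## §3 The pre-registered A10 SHADOW decision rule (PREREG §E P-A10.5) -/

/-- number of `AGREE` verdicts in a list of cell verdicts. [folklore] -/
def agreeCount : List Outcome → ℕ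
  | [] => 0
  | v :: l => (if v = .AGREE then 1 else 0) + agreeCount l

/-- NO-REGRESSION between the frozen router's verdicts `f` and a candidate's shadow verdicts `s` on the
same cells (aligned lists): wherever the frozen word AGREEs, the shadow word AGREEs. Surplus cells of
the longer list are unconstrained (the protocol runs both over the same cell list). [folklore] -/
def noRegression : List Outcome → List Outcome → Bool
  | f :: fs, s :: ss => (!(decide (f = .AGREE)) || decide (s = .AGREE)) && noRegression fs ss
  | _, _ => true

/-- P-A10.5 as a total function: recommend candidate (α)/(β) over the frozen router (γ) iff its shadow
words score `AGREE` on STRICTLY MORE of the hold-out cells (`frozenH` vs `shadowH`) AND there is no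
regression over every cell of record (`frozenAll` vs `shadowAll`). deputy-2's concurrence on the text
is the third, non-mechanical clause and is not modelled. [folklore] -/
def recommend (frozenH shadowH frozenAll shadowAll : List Outcome) : Bool :=
  decide (agreeCount frozenH < agreeCount shadowH) && noRegression frozenAll shadowAll

/-- unfolding of the recommendation into its two mechanical clauses. [folklore] -/
theorem recommend_eq_true_iff (frozenH shadowH frozenAll shadowAll : List Outcome) :
    recommend frozenH shadowH frozenAll shadowAll = true ↔
      agreeCount frozenH < agreeCount shadowH ∧ noRegression frozenAll shadowAll = true := by
  simp [recommend]

/-- no-regression on a pair of nonempty lists, one cell at a time. [folklore] -/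
theorem noRegression_cons (f s : Outcome) (fs ss : List Outcome) :
    noRegression (f :: fs) (s :: ss) = true ↔
      (f = .AGREE → s = .AGREE) ∧ noRegression fs ss = true := by
  simp only [noRegression, Bool.and_eq_true, Bool.or_eq_true, Bool.not_eq_true',
    decide_eq_false_iff_not, decide_eq_true_eq, imp_iff_not_or]

/-- no-regression is reflexive: the frozen router never regresses against itself. [folklore] -/
theorem noRegression_self (l : List Outcome) : noRegression l l = true := by
  induction l with
  | nil => rfl
  | cons a l ih => exact (noRegression_cons a a l l).mpr ⟨id, ih⟩

/-- TIES KEEP (γ): a candidate whose shadow words coincide with the frozen words is never recommended.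
[folklore] -/
theorem recommend_self (h a : List Outcome) : recommend h h a a = false := by
  cases hr : recommend h h a a with
  | false => rfl
  | true =>
    rw [recommend_eq_true_iff] at hr
    exact absurd hr.1 (Nat.lt_irrefl _)

/-- pointwise reading: no-regression says every aligned pair (frozen, shadow) with frozen = AGREE has
shadow = AGREE. [folklore] -/
theorem noRegression_iff_forall_zip : ∀ (f s : List Outcome),
    noRegression f s = true ↔ ∀ pr ∈ f.zip s, pr.1 = .AGREE → pr.2 = .AGREE
  | [], [] => by simp [noRegression]
  | [], _ :: _ => by simp [noRegression]
  | _ :: _, [] => by simp [noRegression]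
  | a :: fs, b :: ss => by
      rw [noRegression_cons, noRegression_iff_forall_zip fs ss]
      simp only [List.zip_cons_cons, List.forall_mem_cons]

/-- under no-regression on aligned lists of equal length the AGREE count cannot drop — so a recommended
candidate never lowers R on the cells of record. [folklore] -/
theorem agreeCount_le_of_noRegression : ∀ {f s : List Outcome}, f.length = s.length →
    noRegression f s = true → agreeCount f ≤ agreeCount s
  | [], [], _, _ => Nat.le_refl _
  | [], _ :: _, h, _ => by simp at h
  | _ :: _, [], h, _ => by simp at h
  | a :: fs, b :: ss, hlen, h => by
      rw [noRegression_cons] at h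
      have ih : agreeCount fs ≤ agreeCount ss :=
        agreeCount_le_of_noRegression (by simpa using hlen) h.2
      simp only [agreeCount]
      by_cases ha : a = .AGREE
      · rw [if_pos ha, if_pos (h.1 ha)]; omega
      · rw [if_neg ha]; split_ifs <;> omega

/-- what a recommendation certifies: strictly more hold-out AGREEs, and every cell the frozen router got
right stays right. [folklore] -/
theorem recommend_sound {frozenH shadowH frozenAll shadowAll : List Outcome}
    (h : recommend frozenH shadowH frozenAll shadowAll = true) :
    agreeCount frozenH < agreeCount shadowH ∧
      ∀ pr ∈ frozenAll.zip shadowAll, pr.1 = .AGREE → pr.2 = .AGREE := by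
  rw [recommend_eq_true_iff] at h
  exact ⟨h.1, (noRegression_iff_forall_zip _ _).mp h.2⟩

section protocolInstances
open Outcome
/-- a candidate that turns two of three hold-out PARTIALs into AGREE and regresses nowhere is
recommended. [folklore] -/
example : recommend [PARTIAL, PARTIAL, PARTIAL] [AGREE, AGREE, PARTIAL]
    [AGREE, AGREE, PARTIAL, PARTIAL] [AGREE, AGREE, AGREE, PARTIAL] = true := by decide
/-- the same hold-out gain with ONE regression on a cell the frozen router got right is vetoed
(P-A10.5 no-regression clause). [folklore] -/
example : recommend [PARTIAL, PARTIAL, PARTIAL] [AGREE, AGREE, PARTIAL]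
    [AGREE, AGREE, PARTIAL, PARTIAL] [AGREE, PARTIAL, AGREE, AGREE] = false := by decide
/-- equal hold-out AGREE counts ⇒ keep (γ), even without regression. [folklore] -/
example : recommend [PARTIAL, AGREE] [AGREE, PARTIAL] [PARTIAL, AGREE] [AGREE, AGREE] = false := by
  decide
end protocolInstances

end RouterScore

end Summit.Ventures.CertifiedManyBodySolver.Downfold

/-! ## §4 The R31 reporting addition (ACCEPTANCE v1.4 §10 R31, deputy-2's CONCURRENCE with P-A10.5):
«the adoption line prints the margin m; an adoption on m = 1 is labelled PROVISIONAL and re-tested under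
both rules on the next blind tranche». The predicate `recommend` is untouched; `margin` and `provisional`
are the printed companions (`validation/score/router/router_score.py a10`). Appended by score-2 (session g4). -/

namespace Summit.Ventures.CertifiedManyBodySolver.Downfold

namespace RouterScore

/-- The AGREE count never exceeds the number of cells. [folklore] -/
theorem agreeCount_le_length : ∀ l : List Outcome, agreeCount l ≤ l.length
  | [] => Nat.le_refl _
  | v :: l => by
      have ih := agreeCount_le_length l
      simp only [agreeCount, List.length_cons]
      split <;> omega

/-- R31 MARGIN m = (AGREE count of the shadow words) − (AGREE count of the frozen words) on the hold-out
cells, as an integer. [folklore] -/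
def margin (frozenH shadowH : List Outcome) : Int := (agreeCount shadowH : Int) - (agreeCount frozenH : Int)

/-- R31 PROVISIONAL label: an adoption whose margin is exactly one. [folklore] -/
def provisional (frozenH shadowH : List Outcome) : Bool := decide (margin frozenH shadowH = 1)

/-- A recommendation (P-A10.5) always carries a positive margin. [folklore] -/
theorem margin_pos_of_recommend {frozenH shadowH frozenAll shadowAll : List Outcome}
    (h : recommend frozenH shadowH frozenAll shadowAll = true) : 0 < margin frozenH shadowH := by
  rw [recommend_eq_true_iff] at h
  simp only [margin]
  omega

/-- A recommendation that is NOT provisional wins by at least two cells. [folklore] -/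
theorem two_le_margin_of_recommend_of_not_provisional {frozenH shadowH frozenAll shadowAll : List Outcome}
    (h : recommend frozenH shadowH frozenAll shadowAll = true) (hp : provisional frozenH shadowH = false) :
    2 ≤ margin frozenH shadowH := by
  have h1 := margin_pos_of_recommend h
  have h2 : margin frozenH shadowH ≠ 1 := by simpa [provisional] using hp
  omega

/-- The margin can never exceed the number of hold-out cells the shadow was scored on (twelve at
calibration close, PREREG Y37). [folklore] -/
theorem margin_le_length (frozenH shadowH : List Outcome) :
    margin frozenH shadowH ≤ (shadowH.length : Int) := by
  have := agreeCount_le_length shadowH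
  simp only [margin]
  omega

/-- Ties: identical shadow and frozen words have margin zero (cf. `recommend_self`). [folklore] -/
theorem margin_self (h : List Outcome) : margin h h = 0 := by
  simp only [margin]
  omega

/-- The FIRST shadow cell of record (PREREG §E 2026-08-26T22:5xZ, INTERIM 1/12): M37 SLCO frozen `PARTIAL`
vs (β) shadow `AGREE` ⇒ margin 1 ⇒ the PROVISIONAL shape; vs (α) shadow `PARTIAL` ⇒ margin 0. An interim
illustration of the arithmetic, not a decision (the rule is evaluated over all twelve cells at close).
[folklore] -/
theorem m37_interim_margins :
    margin [.PARTIAL] [.AGREE] = 1 ∧ provisional [.PARTIAL] [.AGREE] = true ∧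
      margin [.PARTIAL] [.PARTIAL] = 0 ∧ provisional [.PARTIAL] [.PARTIAL] = false := by
  decide

end RouterScore

end Summit.Ventures.CertifiedManyBodySolver.Downfold

/-! ## §5 Adoption cannot lower the R clause (score-2 g6, 2026-08-27): the link between the BLIND hold-out
decision P-A10.5 and its consequence on the whole table. ROUTER §7(3) re-routes every already-routed material
under an adopted amendment; the no-regression conjunct of `recommend` runs over EVERY cell of record, so on
those cells the AGREE count cannot drop (`agreeCount_le_of_noRegression`, §3) and — the new point — the
non-AGREE count cannot grow, hence `rPass` (monotone/antitone, §2) is preserved. The numerals are the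
`validation/score/router/router_score.py a10 --consequence` table of 2026-08-27T02:2xZ (45 worded v1
materials; RUN #8 of record R = 38/45): arithmetic on the ledgers, not a recommendation — the protocol
decides (γ)/(α)/(β) on the twelve Y37 cells only, at calibration close. -/

namespace Summit.Ventures.CertifiedManyBodySolver.Downfold

namespace RouterScore

/-- Under no-regression on aligned lists of equal length the number of NON-AGREE cells cannot grow.
[folklore] -/
theorem sub_agreeCount_le_of_noRegression {f s : List Outcome} (hlen : f.length = s.length)
    (h : noRegression f s = true) : s.length - agreeCount s ≤ f.length - agreeCount f := by
  have h1 := agreeCount_le_of_noRegression hlen h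
  have h2 := agreeCount_le_length s
  omega

/-- The §7 R clause is preserved under no-regression: if the frozen router's verdicts pass «R ≥ 0.90» on a
list of cells, so do a candidate's verdicts on the same cells (more AGREE, no more non-AGREE). [folklore] -/
theorem rPass_of_noRegression {f s : List Outcome} (hlen : f.length = s.length)
    (h : noRegression f s = true) (hR : rPass (agreeCount f) (f.length - agreeCount f) = true) :
    rPass (agreeCount s) (s.length - agreeCount s) = true :=
  rPass_mono (agreeCount_le_of_noRegression hlen h) (sub_agreeCount_le_of_noRegression hlen h) hR

/-- A recommendation (P-A10.5) carries no-regression over the cells of record, hence the adopted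
treatment's AGREE count on those cells is at least the frozen router's. [folklore] -/
theorem agreeCount_le_of_recommend {frozenH shadowH frozenAll shadowAll : List Outcome}
    (hlen : frozenAll.length = shadowAll.length)
    (h : recommend frozenH shadowH frozenAll shadowAll = true) :
    agreeCount frozenAll ≤ agreeCount shadowAll :=
  agreeCount_le_of_noRegression hlen ((recommend_eq_true_iff _ _ _ _).mp h).2

/-- ADOPTION CANNOT LOWER R: if P-A10.5 recommends a treatment and the frozen words already pass the R
clause on the cells of record, the adopted words pass it too. (The converse direction — a failing R made
to pass — is the point of the protocol and is an empirical matter, see `run8_consequence_rPass`.)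
[folklore] -/
theorem rPass_of_recommend {frozenH shadowH frozenAll shadowAll : List Outcome}
    (hlen : frozenAll.length = shadowAll.length)
    (h : recommend frozenH shadowH frozenAll shadowAll = true)
    (hR : rPass (agreeCount frozenAll) (frozenAll.length - agreeCount frozenAll) = true) :
    rPass (agreeCount shadowAll) (shadowAll.length - agreeCount shadowAll) = true :=
  rPass_of_noRegression hlen ((recommend_eq_true_iff _ _ _ _).mp h).2 hR

/-- THE RUN #8 CONSEQUENCE TABLE in integers (`a10 --consequence`, 2026-08-27T02:2xZ; 45 worded v1
materials, 7 non-AGREE): keeping the frozen words (γ) 38 AGREE / 7 other FAILS «R ≥ 0.90»; (α) would flip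
two materials (40/5) and still FAIL; (β) would flip four (42/3) and PASS. With the 14 pending materials all
worded AGREE the three read 52/7 FAIL, 54/5 PASS, 56/3 PASS. Arithmetic only — whether (α)/(β) is ever
adopted is decided blind on the twelve Y37 cells (`recommend`). [folklore] -/
theorem run8_consequence_rPass :
    rPass 38 7 = false ∧ rPass 40 5 = false ∧ rPass 42 3 = true ∧
      rPass 52 7 = false ∧ rPass 54 5 = true ∧ rPass 56 3 = true := by
  decide

end RouterScore

end Summit.Ventures.CertifiedManyBodySolver.Downfold
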